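import Summits.QuantumFields.YangMills.Theorems.BalabanLadderNTBoundaryLawClustering
import HarnessLib

/-!
# Crux `NT` / seam `UVSeamRec` (stmt-QuantumFields-20043): the two-point exterior OSCILLATION of the cube kernel from
# the ONE-point boundary law alone — `|kerCov^η − kerCov^{η'}|(dens_u, dens_{u'}) ≤ 8·8⁸·C₁² / ‖u'−u‖⁸`

Helper file (`--supports stmt-QuantumFields-20043`; owner R78: seam currency №1, THREE-POINT CONJUNCT supply) of the
fleet lead prover of crux `NT` (unit `ym-spine-19353-p1`, g5); route-independent.  CLAUSE SERVED: conjunct 3 (the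
`|Q3| ≥ ε` floor) of the registered `stub_floorsEngine` — this file removes the two-point ceiling (E2-osc) from the
inputs of its supply (sequel `…NTReferenceThreePointNoE2.lean`).

g2's `BoundaryLaw.abs_kerCov_le_of_subcubes` (conditional independence of two separated sub-cubes INSIDE the cube
kernel) turned the route's `FBL` into the sign-free clustering clause `|ν⁸ kerCov| ≤ 4·8⁸C₁²` (`fc2IU_of_fbl`).  Here the
same mechanism is run from the reference currency's ONE-POINT OSCILLATION ceiling (E1-osc) at ONE coupling, with
explicit constants, and read as a TWO-POINT OSCILLATION ceiling:

* `abs_kerCov_le_of_e1osc` — at coupling `β`, spacing `α > 0`: if every femto cube `(c', b')` (`b'·α ≤ ℓ`) obeys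
  `|kerE^ζ(dens x) − kerE^{ζ'}(dens x)| ≤ C₁/depth⁴` (depth `≥ 1`), then on every femto cube `(c, b)`, for every exterior
  `η` and every pair `u, u'` with `16 ≤ ‖u'−u‖ ≤ depth u, depth u'`: `|‖u'−u‖⁸ · kerCov^η(dens_u, dens_{u'})| ≤ 4·8⁸·C₁²`;
* `kerCov_osc_of_e1osc` — hence the exterior oscillation `|kerCov^η − kerCov^{η'}| ≤ 8·8⁸·C₁²/‖u'−u‖⁸`.

For SEPARATED pairs this replaces the registered E2-osc (`C₂/(d⁴(1+‖u'−u‖)⁴)`): it lacks the `(‖u'−u‖/d)⁴` gain, which the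
three-point transfer does not need (the pair oscillation enters multiplied by a one-point oscillation `k = C₁(α/κ)⁴`,
which carries the collar gain) — but which the TWO-point transfer does need (so E2-osc stays in the supply of conjunct 2
by the reference route; the seam's conjunct 2 is supplied by the one-point Markov–mirror package instead).

Refs: `…NTBoundaryLawClustering.lean` (g2), `…NTBoundaryLawClusteringAllCubes.lean` (g2, `fc2IU_of_fbl`, whose proof is
followed here), ENGINE-TARGET-19353 v4.2 (evidence #60 on stmt-QuantumFields-19353).
-/

set_option autoImplicit false

noncomputable section

open MeasureTheory Filter Topology
open Literature.MathematicalPhysics.QuantumFieldTheory Literature.MathematicalPhysics.QuantumLattice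
open Literature.Probability.LatticeModels
open Summit.QuantumFields.YangMills.Cruxes.OSLegsFromFemtoAndGap.DlrCollarTransfer
open Summit.QuantumFields.YangMills.Cruxes.OSLegsFromFemtoAndGap.DlrCollarTransfer.StubLower
  (exists_abs_dens_le le_depth_cube)
open Summit.QuantumFields.YangMills.Theorems.OSLegsFromFemtoAndGap.StubLower (abs_apply_le_norm)

namespace Summit.QuantumFields.YangMills.Cruxes.NT.BoundaryLaw

section PairOsc

variable (G : Type) [Group G] [TopologicalSpace G] [IsTopologicalGroup G] [CompactSpace G]
  [MeasurableSpace G] [BorelSpace G] (r : LatticeRep G)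

/-- **Sign-free pair clustering inside the cube kernel from the one-point OSCILLATION ceiling at one coupling.**
At coupling `β` and spacing `α > 0`, suppose every femto cube `(c', b')` (`b'·α ≤ ℓ`) satisfies
`|kerE^ζ(dens x) − kerE^{ζ'}(dens x)| ≤ C₁/depth(x)⁴` for all exteriors and all `x` of depth `≥ 1`.  Then on every femto
cube `(c, b)`, for every exterior `η` and all `u, u'` with `16 ≤ ‖u'−u‖`, `‖u'−u‖ ≤ depth u`, `‖u'−u‖ ≤ depth u'`:
`|‖u'−u‖⁸ · kerCov^η_{(c,b)}(dens_u, dens_{u'})| ≤ 4·8⁸·C₁²`. [folklore] -/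
theorem abs_kerCov_le_of_e1osc (β : ℝ) {C₁ ℓ α : ℝ} (hC₁ : 0 ≤ C₁) (hα : 0 < α)
    (H1 : ∀ (c : Fin 4 → ℤ) (b : ℕ), (b : ℝ) * α ≤ ℓ → ∀ (η η' : LGConfig 4 G) (x : Fin 4 → ℤ), 1 ≤ depth c b x →
      |kerE G r β c b η (dens G r x) - kerE G r β c b η' (dens G r x)| ≤ C₁ / (depth c b x : ℝ) ^ 4)
    {c : Fin 4 → ℤ} {b : ℕ} (hb : (b : ℝ) * α ≤ ℓ) (η : LGConfig 4 G) (u u' : Fin 4 → ℤ)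
    (hn : (16 : ℝ) ≤ ‖siteToE (u' - u)‖) (hKu : ‖siteToE (u' - u)‖ ≤ depth c b u)
    (hKu' : ‖siteToE (u' - u)‖ ≤ depth c b u') :
    |‖siteToE (u' - u)‖ ^ 8 * kerCov G r β c b η (dens G r u) (dens G r u')| ≤ 4 * 8 ^ 8 * C₁ ^ 2 := by
  haveI := r.secondCountableTopology
  obtain ⟨M, -, hM⟩ := exists_abs_dens_le G r
  set ν : ℝ := ‖siteToE (u' - u)‖ with hν
  have hν0 : 0 < ν := by linarith
  -- a long coordinate `j₀`: `ν ≤ 2 |u' j₀ − u j₀| ≤ 2 ν`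
  obtain ⟨j₀, hj₀⟩ := exists_coord_ge_half_norm (u' - u)
  rw [Pi.sub_apply, Int.cast_sub] at hj₀
  have hle_ν : |((u' j₀ : ℤ) : ℝ) - u j₀| ≤ ν := by
    have := abs_apply_le_norm (siteToE (u' - u)) j₀
    rwa [siteToE_apply, Pi.sub_apply, Int.cast_sub] at this
  -- the integer distance `m` and the radius `R₁ = ⌊(m − 3)/2⌋`
  obtain ⟨m, hm⟩ : ∃ m : ℕ, (m : ℤ) = |u' j₀ - u j₀| := ⟨(u' j₀ - u j₀).natAbs, Int.natCast_natAbs _⟩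
  have hmR : (m : ℝ) = |((u' j₀ : ℤ) : ℝ) - u j₀| := by
    have := congrArg (fun z : ℤ => (z : ℝ)) hm
    simpa [Int.cast_abs, Int.cast_sub] using this
  have hm8 : 8 ≤ m := by
    have : (8 : ℝ) ≤ m := by rw [hmR]; linarith
    exact_mod_cast this
  obtain ⟨R₁, hR₁⟩ : ∃ R₁ : ℕ, R₁ = (m - 3) / 2 := ⟨_, rfl⟩
  have hR₁1 : 1 ≤ R₁ := by omega
  have hR₁m : 2 * R₁ + 3 ≤ m := by omega
  have hmR₁ : m ≤ 2 * R₁ + 4 := by omega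
  have hfar : 2 * (R₁ : ℤ) + 3 ≤ |u' j₀ - u j₀| := by rw [← hm]; exact_mod_cast hR₁m
  have hfar2 : (R₁ : ℤ) + 2 ≤ |u' j₀ - u j₀| := by
    have : (0 : ℤ) ≤ R₁ := by positivity
    linarith
  have hνR₁ : ν / 8 ≤ (R₁ : ℝ) + 1 := by
    have h1 : (m : ℝ) ≤ 2 * R₁ + 4 := by exact_mod_cast hmR₁
    rw [hmR] at h1
    linarith
  have hR₁ν : (R₁ : ℝ) + 1 ≤ ν := by
    have h1 : (2 * R₁ + 3 : ℝ) ≤ m := by exact_mod_cast hR₁m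
    rw [hmR] at h1
    linarith
  -- the sub-cubes `Q_u`, `Q_{u'}` of radius `R₁` fit in `Q`
  have hdu : R₁ + 1 ≤ depth c b u := by
    have : ((R₁ + 1 : ℕ) : ℝ) ≤ depth c b u := by push_cast; linarith
    exact_mod_cast this
  have hdu' : R₁ + 1 ≤ depth c b u' := by
    have : ((R₁ + 1 : ℕ) : ℝ) ≤ depth c b u' := by push_cast; linarith
    exact_mod_cast this
  have hsubu : cubeEdges (fun j => u j - R₁) (2 * R₁ + 1) ⊆ cubeEdges c b :=
    cubeEdges_subset (centredCube_subset_of_le_depth hdu)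
  have hsubu' : cubeEdges (fun j => u' j - R₁) (2 * R₁ + 1) ⊆ cubeEdges c b :=
    cubeEdges_subset (centredCube_subset_of_le_depth hdu')
  -- the sub-cubes are femto
  have hside : 2 * R₁ + 1 ≤ b := two_mul_add_one_le_of_le_depth hdu
  have hb₁ : ((2 * R₁ + 1 : ℕ) : ℝ) * α ≤ ℓ := by
    have h2 : ((2 * R₁ + 1 : ℕ) : ℝ) ≤ (b : ℝ) := by exact_mod_cast hside
    exact (mul_le_mul_of_nonneg_right h2 hα.le).trans hb
  -- the one-point oscillation in each sub-cube at its centre, against the reference exterior `η`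
  have hbl : ∀ (v : Fin 4 → ℤ) (ζ : LGConfig 4 G),
      |kerE G r β (fun j => v j - R₁) (2 * R₁ + 1) ζ (dens G r v) -
        kerE G r β (fun j => v j - R₁) (2 * R₁ + 1) η (dens G r v)| ≤ C₁ / ((R₁ : ℝ) + 1) ^ 4 := by
    intro v ζ
    have hdv := le_depth_cube v v R₁ (t := 0) (fun j => by simp)
    rw [sub_zero] at hdv
    have h1v : 1 ≤ depth (fun j => v j - R₁) (2 * R₁ + 1) v := by
      have : ((1 : ℕ) : ℝ) ≤ depth (fun j => v j - R₁) (2 * R₁ + 1) v := by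
        have : (1 : ℝ) ≤ (R₁ : ℝ) + 1 := by
          have : (0 : ℝ) ≤ R₁ := by positivity
          linarith
        push_cast; linarith
      exact_mod_cast this
    refine (H1 _ _ hb₁ ζ η v h1v).trans ?_
    exact div_le_div_of_nonneg_left hC₁ (by positivity) (pow_le_pow_left₀ (by positivity) hdv 4)
  -- conditional independence: `|kerCov| ≤ 4 h²`, `h = C₁/(R₁+1)⁴`
  have hcyl : IsCylinder (fun ζ => kerE G r β (fun j => u j - R₁) (2 * R₁ + 1) ζ (dens G r u))
      (r.curvature.supp.image (fun e => (e.1 + u, e.2)) ∪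
        (plaquettesTouching (cubeEdges (fun j => u j - R₁) (2 * R₁ + 1))).biUnion plaquetteEdges) := by
    unfold kerE
    exact dependsOn_integral_ymSpecification r.ρ r.continuous β _ (continuous_dens r u).measurable
      (StubLower.isCylinder_dens G r u)
  have hcov := abs_kerCov_le_of_subcubes G r β hsubu hsubu' η (continuous_dens r u) (continuous_dens r u')
    (hM u) (hM u') (StubLower.isCylinder_dens G r u') (dens_supp_not_mem_cube G r hfar2) hcyl
    (condMean_supp_not_mem_cube G r hfar) (hbl u) (hbl u')
  -- arithmetic: `ν⁸ · 4 (C₁/(R₁+1)⁴)² ≤ 4 · 8⁸ C₁²` since `ν/8 ≤ R₁ + 1`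
  have hh : C₁ / ((R₁ : ℝ) + 1) ^ 4 ≤ C₁ / (ν / 8) ^ 4 :=
    div_le_div_of_nonneg_left hC₁ (by positivity) (pow_le_pow_left₀ (by positivity) hνR₁ 4)
  have hh0 : 0 ≤ C₁ / ((R₁ : ℝ) + 1) ^ 4 := by positivity
  rw [abs_mul, abs_of_nonneg (by positivity : (0 : ℝ) ≤ ν ^ 8)]
  calc ν ^ 8 * |kerCov G r β c b η (dens G r u) (dens G r u')|
      ≤ ν ^ 8 * (4 * (C₁ / ((R₁ : ℝ) + 1) ^ 4) * (C₁ / ((R₁ : ℝ) + 1) ^ 4)) :=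
        mul_le_mul_of_nonneg_left hcov (by positivity)
    _ ≤ ν ^ 8 * (4 * (C₁ / (ν / 8) ^ 4) * (C₁ / (ν / 8) ^ 4)) := by gcongr
    _ = 4 * 8 ^ 8 * C₁ ^ 2 := by field_simp

/-- **The two-point exterior OSCILLATION of the cube kernel from the one-point oscillation ceiling** (same hypotheses):
`|kerCov^η(dens_u, dens_{u'}) − kerCov^{η'}(dens_u, dens_{u'})| ≤ 8·8⁸·C₁² / ‖u'−u‖⁸`. [folklore] -/
theorem kerCov_osc_of_e1osc (β : ℝ) {C₁ ℓ α : ℝ} (hC₁ : 0 ≤ C₁) (hα : 0 < α)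
    (H1 : ∀ (c : Fin 4 → ℤ) (b : ℕ), (b : ℝ) * α ≤ ℓ → ∀ (η η' : LGConfig 4 G) (x : Fin 4 → ℤ), 1 ≤ depth c b x →
      |kerE G r β c b η (dens G r x) - kerE G r β c b η' (dens G r x)| ≤ C₁ / (depth c b x : ℝ) ^ 4)
    {c : Fin 4 → ℤ} {b : ℕ} (hb : (b : ℝ) * α ≤ ℓ) (η η' : LGConfig 4 G) (u u' : Fin 4 → ℤ)
    (hn : (16 : ℝ) ≤ ‖siteToE (u' - u)‖) (hKu : ‖siteToE (u' - u)‖ ≤ depth c b u)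
    (hKu' : ‖siteToE (u' - u)‖ ≤ depth c b u') :
    |kerCov G r β c b η (dens G r u) (dens G r u') - kerCov G r β c b η' (dens G r u) (dens G r u')| ≤
      8 * 8 ^ 8 * C₁ ^ 2 / ‖siteToE (u' - u)‖ ^ 8 := by
  set ν : ℝ := ‖siteToE (u' - u)‖ with hν
  have hν0 : 0 < ν := by linarith
  have hν8 : 0 < ν ^ 8 := by positivity
  have h1 := abs_kerCov_le_of_e1osc G r β hC₁ hα H1 hb η u u' hn hKu hKu'
  have h2 := abs_kerCov_le_of_e1osc G r β hC₁ hα H1 hb η' u u' hn hKu hKu'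
  rw [abs_mul, abs_of_nonneg hν8.le] at h1 h2
  have h1' : |kerCov G r β c b η (dens G r u) (dens G r u')| ≤ 4 * 8 ^ 8 * C₁ ^ 2 / ν ^ 8 := by
    rw [le_div_iff₀ hν8]; linarith
  have h2' : |kerCov G r β c b η' (dens G r u) (dens G r u')| ≤ 4 * 8 ^ 8 * C₁ ^ 2 / ν ^ 8 := by
    rw [le_div_iff₀ hν8]; linarith
  calc |kerCov G r β c b η (dens G r u) (dens G r u') - kerCov G r β c b η' (dens G r u) (dens G r u')|
      ≤ |kerCov G r β c b η (dens G r u) (dens G r u')| + |kerCov G r β c b η' (dens G r u) (dens G r u')| :=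
        abs_sub _ _
    _ ≤ 4 * 8 ^ 8 * C₁ ^ 2 / ν ^ 8 + 4 * 8 ^ 8 * C₁ ^ 2 / ν ^ 8 := add_le_add h1' h2'
    _ = 8 * 8 ^ 8 * C₁ ^ 2 / ν ^ 8 := by ring

end PairOsc

end Summit.QuantumFields.YangMills.Cruxes.NT.BoundaryLaw

end
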